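import Literature.IUT.HodgeTheaters.SurfaceGroupFiniteIndexDischarge
import Literature.IUT.HodgeTheaters.ProfiniteCompletionFiniteIndexIso
import Literature.IUT.HodgeTheaters.ProfiniteCompletionLifting
import HarnessLib

/-!
# Open subgroups of a profinite completion are profinite completions of finite-index subgroups;
# "a group as in [IUTchI] Theorem 2.6" is preserved by passing to open subgroups of the completion

Mochizuki, *Inter-universal Teichmüller theory I* (kurims, May 2020), §2, Thm 2.6 pp. 56–57 ("`F` a group
that is either a free discrete group of finite rank or an orientable surface group … `F̂` its profinite
completion") and Cor 2.8 p. 59 (subgroups of topological fundamental groups of complex hyperbolic curves: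
finite étale coverings of hyperbolic curves are hyperbolic curves) [cite: Mochizuki2012, Thm 2.6 pp.56-57]
(D-0012 claim key; plain (pro)finite group theory here, no side taken).  PROOF-ONLY infrastructure
(seat abc-iut-w5-d119), packaging three steps that several §2 files redo inline
(`ProfiniteCompletionFreeAbelianTorsionFree`, `FreeProfiniteOpenSubgroups`, my
`ProfiniteCompletionSurfaceAbelianTorsionFree`):

* `ProfiniteCompletion.finiteIndex_comap_of_isOpen` — for `U ⊆ Ĝ` open, `H := η⁻¹(U) ≤ G` has finite index;
* `ProfiniteCompletion.topologicalClosure_map_comap_of_isOpen` — `cl η(H) = U` (η(G) ∩ U is dense in the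
  open-closed `U`);
* `ProfiniteCompletion.exists_continuousMulEquiv_of_isOpen` — **`U ≃ₜ* Ĥ`** compatibly with `η`
  (abc-iut-L5-d2's `exists_continuousMulEquiv` for finite-index subgroups + the two facts above);
* with the tree's UNCONDITIONAL `IsFreeOrSurface.subgroup_of_finiteIndex'`
  (`SurfaceGroupFiniteIndexDischarge.lean`: Schreier + Nielsen–Schreier on the free side, F_cov on the
  surface side) the capstone **`IsFreeOrSurface.exists_of_isOpen_profiniteCompletion`**: every open subgroup of `F̂`, `F` as in
  Theorem 2.6, is (as a topological group) the profinite completion of a group as in Theorem 2.6 — the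
  group-theoretic content of "finite étale coverings of hyperbolic curves are hyperbolic curves".

No new definition, no new Literature fact; nothing here bears on [IUTchIII] Cor. 3.12.
-/

namespace Literature.IUT.HodgeTheaters

open CategoryTheory ProfiniteGrp ProfiniteGrp.ProfiniteCompletion Topology

universe u

namespace ProfiniteCompletion

variable {G : Type u} [Group G]

/-- For an open subgroup `U ⊆ Ĝ`, the discrete trace `η⁻¹(U) ≤ G` has finite index (it contains a
finite-index normal level `N₀`). [cite: Mochizuki2012, Thm 2.6 p.56] -/
theorem finiteIndex_comap_of_isOpen (U : Subgroup (profiniteCompletion G))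
    (hU : IsOpen (U : Set (profiniteCompletion G))) : (U.comap (toCompletion G)).FiniteIndex := by
  obtain ⟨N₀, hN₀⟩ := exists_val_eq_one_mem_of_isOpen hU
  refine Subgroup.finiteIndex_of_le (H := N₀.toSubgroup) fun g hg => ?_
  change toCompletion G g ∈ U
  apply hN₀
  change (QuotientGroup.mk g : G ⧸ N₀.toSubgroup) = 1
  rw [QuotientGroup.eq_one_iff]
  exact hg

/-- For an open subgroup `U ⊆ Ĝ`: the closure of `η(η⁻¹ U)` is `U` itself (`U` is closed, and
`η(G) ∩ U = η(η⁻¹U)` is dense in the open set `U`). [cite: Mochizuki2012, Thm 2.6 p.56] -/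
theorem topologicalClosure_map_comap_of_isOpen (U : Subgroup (profiniteCompletion G))
    (hU : IsOpen (U : Set (profiniteCompletion G))) :
    ((U.comap (toCompletion G)).map (toCompletion G)).topologicalClosure = U := by
  apply le_antisymm
  · exact Subgroup.topologicalClosure_minimal _ (Subgroup.map_comap_le _ _)
      (Subgroup.isClosed_of_isOpen U hU)
  · intro u hu
    rw [mem_topologicalClosure_map_iff, mem_closure_iff]
    intro O hO huO
    obtain ⟨g, hg⟩ := (denseRange (GrpCat.of G)).exists_mem_open (hO.inter hU) ⟨u, huO, hu⟩
    exact ⟨toCompletion G g, hg.1, ⟨g, hg.2, rfl⟩⟩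

/-- **Open subgroups of `Ĝ` are profinite completions**: for `U ⊆ Ĝ` open and `H := η⁻¹(U)` (finite
index), there is an isomorphism of topological groups `Ĥ ≃ₜ* U` carrying `η_H(h)` to `η_G(h)`.
[cite: Mochizuki2012, Thm 2.6 p.56] -/
theorem exists_continuousMulEquiv_of_isOpen (U : Subgroup (profiniteCompletion G))
    (hU : IsOpen (U : Set (profiniteCompletion G))) :
    ∃ e : profiniteCompletion ↥(U.comap (toCompletion G)) ≃ₜ* U,
      ∀ h : U.comap (toCompletion G),
        ((e (toCompletion _ h) : U) : profiniteCompletion G) = toCompletion G (h : G) := by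
  haveI := finiteIndex_comap_of_isOpen U hU
  obtain ⟨e, he⟩ := exists_continuousMulEquiv (U.comap (toCompletion G))
  have hcl := topologicalClosure_map_comap_of_isOpen U hU
  -- the identity `cl η(H) = U` as an isomorphism of topological groups
  let c : ((U.comap (toCompletion G)).map (toCompletion G)).topologicalClosure ≃ₜ* U :=
    { MulEquiv.subgroupCongr hcl with
      continuous_toFun := by
        apply Continuous.subtype_mk
        exact continuous_subtype_val
      continuous_invFun := by
        apply Continuous.subtype_mk
        exact continuous_subtype_val }
  refine ⟨e.trans c, fun h => ?_⟩
  change (((MulEquiv.subgroupCongr hcl) (e (toCompletion _ h)) : U) : profiniteCompletion G) = _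
  rw [MulEquiv.subgroupCongr_apply]
  exact he h

end ProfiniteCompletion

/-! ### "A group as in Theorem 2.6" passes to open subgroups of `F̂` -/

/-- **Open subgroups of `F̂`, `F` as in Theorem 2.6, are profinite completions of groups as in Theorem 2.6**
(the group-theoretic shadow of "finite étale coverings of hyperbolic curves are hyperbolic curves",
Cor 2.8): for `U ⊆ F̂` open, `H := η⁻¹(U)` is a finite-index subgroup of `F`, hence again free of finite
rank / an orientable surface group, and `U ≃ₜ* Ĥ`. [cite: Mochizuki2012, Cor 2.8 p.59] -/
theorem IsFreeOrSurface.exists_of_isOpen_profiniteCompletion {F : Type u} [Group F]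
    (hF : IsFreeOrSurface F) (U : Subgroup (profiniteCompletion F))
    (hU : IsOpen (U : Set (profiniteCompletion F))) :
    (U.comap (toCompletion F)).FiniteIndex ∧
      IsFreeOrSurface ↥(U.comap (toCompletion F)) ∧
      Nonempty (profiniteCompletion ↥(U.comap (toCompletion F)) ≃ₜ* U) := by
  haveI := ProfiniteCompletion.finiteIndex_comap_of_isOpen U hU
  obtain ⟨e, -⟩ := ProfiniteCompletion.exists_continuousMulEquiv_of_isOpen U hU
  exact ⟨inferInstance, hF.subgroup_of_finiteIndex' _, ⟨e⟩⟩

end Literature.IUT.HodgeTheaters
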